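import Mathlib.AlgebraicTopology.FundamentalGroupoid.SimplyConnected
import Mathlib.Topology.ContinuousMap.Basic
import HarnessLib

/-!
# A subset onto which every compact part of a simply connected set retracts is simply connected

Topic `Literature/AlgebraicTopology/FundamentalGroupoid`. The compactness form of "a retract of
a simply connected space is simply connected" (A. Hatcher, *Algebraic Topology* (2002),
Prop. 1.17; tree: `IsSimplyConnected.of_retraction`, `HCobordismLevelSimplyConnected.lean`):
paths and null-homotopies have compact images, so it suffices that every COMPACT subset `K` of
the simply connected set `A` is retracted into `T` by a map continuous on `K` fixing the points
of `T ∩ K`: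

* `Literature.AlgebraicTopology.FundamentalGroupoid.IsSimplyConnected.of_compact_retractions`.

Typical use (J. Milnor, *Morse theory* (1963), §3 Thm. 3.1, for a size function `ρ` of the open
`E₈` plumbing, Kosinski 1993, VI.12): `A = {0 < ρ < ε₀}`, `T = {0 < ρ ≤ ε}`; a compact `K ⊆ A`
lies in `{0 < ρ ≤ ε'}` for some `ε' < ε₀`, which retracts onto `T` by the identity below `ε`
and Milnor's retraction of the slab `ρ⁻¹[ε, ε']` onto its bottom level
(`RegularSlabOfProper.lean`); likewise `T = {ρ = ε}` inside `{0 < ρ ≤ ε}`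
(`LevelSetSimplyConnected.lean` is the special case). Everything is proved; no definitions.

## References

* A. Hatcher, *Algebraic Topology*, CUP 2002, Prop. 1.17. [HatcherAT2002]
* J. Milnor, *Morse theory*, Ann. of Math. Studies 51 (1963), §3 Thm. 3.1. [Milnor1963]
-/

noncomputable section

open Set Topology unitInterval

namespace Literature.AlgebraicTopology.FundamentalGroupoid

variable {X : Type*} [TopologicalSpace X]

/-- **Compact retractions suffice.** Let `T ⊆ A ⊆ X` with `A` simply connected, and suppose
that for every compact `K ⊆ A` there is a map `r : X → X`, continuous on `K`, with
`r(K) ⊆ T` and `r x = x` for `x ∈ K ∩ T`. Then `T` is simply connected (Hatcher, Prop. 1.17,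
with the compactness of `I` and `I × I`). [cite: HatcherAT2002, Prop. 1.17] -/
theorem IsSimplyConnected.of_compact_retractions {A T : Set X} (hA : IsSimplyConnected A)
    (hTA : T ⊆ A)
    (hret : ∀ K : Set X, IsCompact K → K ⊆ A →
      ∃ r : X → X, ContinuousOn r K ∧ MapsTo r K T ∧ ∀ x ∈ K, x ∈ T → r x = x) :
    IsSimplyConnected T := by
  rw [isSimplyConnected_iff_exists_homotopy_refl_forall_mem] at hA ⊢
  obtain ⟨hApc, hAloop⟩ := hA
  refine ⟨?_, fun x p hp => ?_⟩
  · -- path connected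
    obtain ⟨x₁, hx₁⟩ := hApc.nonempty
    have hne : T.Nonempty := by
      obtain ⟨r, -, hrT, -⟩ := hret {x₁} isCompact_singleton (singleton_subset_iff.2 hx₁)
      exact ⟨r x₁, hrT (mem_singleton x₁)⟩
    refine ⟨hne.some, hne.some_mem, fun y hy => ?_⟩
    have hx : hne.some ∈ T := hne.some_mem
    obtain ⟨γ, hγ⟩ := hApc.joinedIn _ (hTA hx) y (hTA hy)
    obtain ⟨r, hr, hrT, hid⟩ := hret (range γ) (isCompact_range γ.continuous)
      (by rintro _ ⟨t, rfl⟩; exact hγ t)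
    have hcont : Continuous fun t : I => r (γ t) :=
      hr.comp_continuous γ.continuous fun t => ⟨t, rfl⟩
    refine ⟨⟨⟨fun t => r (γ t), hcont⟩, ?_, ?_⟩, fun t => hrT ⟨t, rfl⟩⟩
    · show r (γ 0) = hne.some
      rw [γ.source]; exact hid _ ⟨0, γ.source⟩ hx
    · show r (γ 1) = y
      rw [γ.target]; exact hid _ ⟨1, γ.target⟩ hy
  · -- loops
    obtain ⟨F, hF⟩ := hAloop x p fun t => hTA (hp t)
    have hx : x ∈ T := by simpa using hp 0
    obtain ⟨r, hr, hrT, hid⟩ := hret (range F) (isCompact_range F.continuous)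
      (by rintro _ ⟨q, rfl⟩; exact hF q)
    have hcont : Continuous fun q : I × I => r (F q) :=
      hr.comp_continuous F.continuous fun q => ⟨q, rfl⟩
    have hpt : ∀ t, p t ∈ range F := fun t => ⟨(0, t), F.apply_zero t⟩
    have hxK : x ∈ range F := ⟨(1, 0), by rw [F.apply_one]; rfl⟩
    refine ⟨{ toFun := fun q => r (F q)
              continuous_toFun := hcont
              map_zero_left := fun t => ?_
              map_one_left := fun t => ?_
              prop' := fun s t ht => ?_ }, fun q => hrT ⟨q, rfl⟩⟩
    · show r (F (0, t)) = p t
      rw [F.apply_zero]; exact hid _ (hpt t) (hp t)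
    · show r (F (1, t)) = (Path.refl x) t
      rw [F.apply_one]; exact hid _ hxK hx
    · show r (F (s, t)) = p t
      have h := F.prop' s t ht
      simp only [ContinuousMap.coe_mk] at h ⊢
      change F (s, t) = p t at h
      rw [h]; exact hid _ (hpt t) (hp t)

end Literature.AlgebraicTopology.FundamentalGroupoid
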